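import Summits.QuantumFields.YangMills.Theorems.BalabanUVNodesK0RecordFormatNamesLocD
import Summits.QuantumFields.YangMills.Theorems.BalabanUVNodesK0RecordFormatNamesLemmas11

/-!
# K0⁷ record FORMAT⁺ names — lemma file 12: faces of EDITION 16e (`Response9DLocW₂ ∕ Response9DLocAt₂`)

Companion of `…K0RecordFormatNamesLocD`.  Kernel-checked bookkeeping; nothing of Bałaban's asserted.  DEFINER seat `ym-nodeO-def-1` (gen 34); `--kind proof --supports stmt-QuantumFields-20541
--as helper`; count-neutral.
* §1 projections `Response9DLocW₂.consts_nonneg ∕ .decay` (NO no-wrap hypothesis) `∕ .unwrap ∕ .twoVol ∕ .intertwine`; the implications `Response9DLocW₂ → Response9DLocW` (the struck guard only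
  weakened the old row), `Response9DLoc → Response9DLocW₂`, `Response9D → Response9DLocW₂`.
* §2 the receipt at the nest radii unfolded (`Iff.rfl`) and `Response9DLocAt₂ → Response9DLocAt` at equal parameters.
HONEST FRAMING.  Bookkeeping; decay ∕ transport ∕ (E4a)-Locξ NOT proved here; 27931 v11-Loc not yet cut∕signed; K0⁷ NOT closed; NODE O 0∕1; COUNT 8∕28 · K 1∕4 UNMOVED; finite 𝕋⁴ at
fixed ε — not continuum ∕ OS ∕ Clay; the Yang–Mills mass gap is NOT proved by any of this.
-/

noncomputable section

open scoped BigOperators Matrix.Norms.L2Operator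

namespace Summit.QuantumFields.YangMills.Theorems.K0RecordFormatNames

open Literature.MathematicalPhysics.QuantumFieldTheory.Balaban1983to89
open Literature.MathematicalPhysics.QuantumFieldTheory.Balaban1983to89.Node00
open Literature.MathematicalPhysics.QuantumFieldTheory.Balaban1983to89.T4Continuum (T4Family)
open Literature.MathematicalPhysics.QuantumFieldTheory.Balaban1983to89.B12FormatPlus (cutTo restrictCLM Response9D)

/-! ## §1  Projections and implications -/

section Generic

variable {S : ℕ → LocDomainSys} {M m : ℕ → ℕ} {d : ℕ} {R : B12FormatPlus.Response9Data S M m d}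
  {χ : (n : ℕ) → (S n).Dom → (Fin (m n) → ℂ) → (Fin (M n) → ℂ)} {N : ℕ → ℕ} {D : (n : ℕ) → (S n).Dom → Set (Fin (m n) → ℂ)}
  {inner : (n : ℕ) → R.Λ n → Prop} {nowrap : ℕ → Prop} {C₉ δ₀ : ℝ}

/-- (R0) of `Response9DLocW₂`. [cite: Balaban1985Variational, Prop. 9 p.309 (bookkeeping)] -/
theorem Response9DLocW₂.consts_nonneg (h : Response9DLocW₂ R χ N D inner nowrap C₉ δ₀) : 0 ≤ C₉ ∧ 0 ≤ δ₀ := ⟨h.1, h.2.1⟩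

/-- (R1ᴰ-Loc) of `Response9DLocW₂`: the input-guarded decay row, in EVERY member (no centring hypothesis). [cite: Balaban1985Variational, Prop. 9 p.309, (190) p.308; Balaban1987RG1, (4.5) p.282] -/
theorem Response9DLocW₂.decay (h : Response9DLocW₂ R χ N D inner nowrap C₉ δ₀) (n : ℕ) (X : (S n).Dom) (y : R.Λ n)
    (hX : ∀ i ∈ R.cX n X, inner n (R.siteOf n i)) :
    gauge (D n X) (cutTo (R.cX n X) (R.Gk n y)) ≤ C₉ * Real.exp (-δ₀ * (R.G n).distD y X) :=
  h.2.2.1 n X y hX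

/-- (R3) of `Response9DLocW₂`. [cite: Balaban1987RG1, (1.21) p.264] -/
theorem Response9DLocW₂.unwrap (h : Response9DLocW₂ R χ N D inner nowrap C₉ δ₀) (n : ℕ) (X : (S n).Dom) (hX : X ∉ R.wrap n)
    (i : Fin (m n)) (hi : i ∈ R.cX n X) : R.jX n X i ∈ R.cX (n + 1) (R.emb n X) :=
  h.2.2.2.1 n X hX i hi

/-- (R4ᴰ-Loc) of `Response9DLocW₂`: the two-volume comparison under the centring guards of members `n`, `n + 1`. [cite: Balaban1987RG1, (1.21) p.264, (4.35) p.290] -/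
theorem Response9DLocW₂.twoVol (h : Response9DLocW₂ R χ N D inner nowrap C₉ δ₀) (n : ℕ) (X : (S n).Dom) (hX : X ∉ R.wrap n) (hn : nowrap n)
    (hn' : nowrap (n + 1)) (μ : Fin d) (z : Fin d → ℤ) (hz : ∀ l, 2 * |z l| < (N n : ℤ)) :
    gauge (D n X) (cutTo (R.cX n X) fun i => R.Gk (n + 1) (R.e (n + 1) μ z) (R.jX n X i) - R.Gk n (R.e n μ z) i) ≤
      C₉ * Real.exp (-δ₀ * (N n : ℝ) / 2) * Real.exp (-(δ₀ / 2) * (R.G n).distD (R.e n μ z) X) :=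
  h.2.2.2.2.1 n X hX hn hn' μ z hz

/-- (R5) of `Response9DLocW₂`. [cite: Balaban1987RG1, (4.35) p.290] -/
theorem Response9DLocW₂.intertwine (h : Response9DLocW₂ R χ N D inner nowrap C₉ δ₀) (n : ℕ) (X : (S n).Dom) (hX : X ∉ R.wrap n)
    (w' : Fin (m (n + 1)) → ℂ) : R.πc n X (χ (n + 1) (R.emb n X) w') = χ n X (restrictCLM (R.cX n X) (R.jX n X) w') :=
  h.2.2.2.2.2 n X hX w'

/-- `Response9DLocW₂` implies ed.16c's `Response9DLocW` (whose decay row is the same row under an extra hypothesis). [cite: Balaban1985Variational, Prop. 9 p.309 (bookkeeping)] -/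
theorem response9DLocW_of_response9DLocW₂ (h : Response9DLocW₂ R χ N D inner nowrap C₉ δ₀) : Response9DLocW R χ N D inner nowrap C₉ δ₀ :=
  ⟨h.1, h.2.1, fun n X y _ hX => h.2.2.1 n X y hX, h.2.2.2.1, h.2.2.2.2.1, h.2.2.2.2.2⟩

/-- ed.16b's `Response9DLoc` (unguarded two-volume row) implies `Response9DLocW₂` for every `nowrap`. [cite: Balaban1985Variational, Prop. 9 p.309 (bookkeeping)] -/
theorem response9DLocW₂_of_response9DLoc (nowrap : ℕ → Prop) (h : Response9DLoc R χ N D inner C₉ δ₀) : Response9DLocW₂ R χ N D inner nowrap C₉ δ₀ :=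
  ⟨h.1, h.2.1, h.2.2.1, h.2.2.2.1, fun n X hX _ _ => h.2.2.2.2.1 n X hX, h.2.2.2.2.2⟩

/-- The unguarded `Response9D` implies `Response9DLocW₂` for every `inner`, `nowrap`. [cite: Balaban1985Variational, Prop. 9 p.309 (bookkeeping)] -/
theorem response9DLocW₂_of_response9D (inner : (n : ℕ) → R.Λ n → Prop) (nowrap : ℕ → Prop) (h : Response9D R χ N D C₉ δ₀) :
    Response9DLocW₂ R χ N D inner nowrap C₉ δ₀ :=
  response9DLocW₂_of_response9DLoc nowrap (response9DLoc_of_response9D inner h)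

end Generic

/-! ## §2  The record receipt `Response9DLocAt₂` -/

variable (F : T4Family)

/-- `Response9DLocAt₂` AT THE NEST RADII, unfolded to `Response9DLocW₂` over `InInnerCube ∕ WindowNoWrap` (`Iff.rfl`). [cite: Balaban1987RG1, (4.35) p.290 (bookkeeping)] -/
theorem response9DLocAt₂_nest_iff (θ : Stage13Params F 2) (a : θ.ιβ) (Mc k K₀ : ℕ) (z₀ : Fin 4 → ℤ) (α₂ C₉ δ₀ : ℝ) :
    Response9DLocAt₂ F θ a Mc k K₀ (nestRadius Mc 5) (nestRadius Mc 3) z₀ α₂ C₉ δ₀ ↔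
      Response9DLocW₂ (recordResponse9DataFromLocAtξ F θ a Mc k K₀ (nestRadius Mc 5) z₀) (fun n => recordChartJ F Mc k (K₀ + n))
        (fun n => recordRNat F Mc k (K₀ + n)) (fun n X => recordDom44J F Mc k (K₀ + n) X α₂) (fun n l => InInnerCube F Mc k (K₀ + n) z₀ l)
        (fun n => WindowNoWrap F Mc k (K₀ + n) z₀) C₉ δ₀ :=
  Iff.rfl

/-- At equal parameters the v11 receipt implies the v10 receipt. [cite: Balaban1987RG1, (4.35) p.290 (bookkeeping)] -/
theorem response9DLocAt_of_response9DLocAt₂ (θ : Stage13Params F 2) (a : θ.ιβ) (Mc k K₀ R0 R3 : ℕ) (z₀ : Fin 4 → ℤ) (α₂ C₉ δ₀ : ℝ)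
    (h : Response9DLocAt₂ F θ a Mc k K₀ R0 R3 z₀ α₂ C₉ δ₀) : Response9DLocAt F θ a Mc k K₀ R0 R3 z₀ α₂ C₉ δ₀ :=
  response9DLocW_of_response9DLocW₂ h

end Summit.QuantumFields.YangMills.Theorems.K0RecordFormatNames

end
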